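/- Fleet lead `ym-wcr-19456-p1` (seat g2), route `WeakCouplingRates`, crux `ColdBoxTwoPointFloorW` (stmt-QuantumFields-19608). -/
import Summits.QuantumFields.YangMills.Theorems.WeakCouplingRatesColdBoxIndex
import Summits.QuantumFields.YangMills.Theorems.WeakCouplingRatesColdBoxChartProduct
import Summits.QuantumFields.YangMills.Theorems.WeakCouplingRatesColdBoxCubic
import Summits.QuantumFields.YangMills.Theorems.WeakCouplingRatesColdBoxGoodReduction
import Summits.QuantumFields.YangMills.Theorems.WeakCouplingRatesColdBoxDirichletForm

/-!
# Crux `ColdBoxTwoPointFloorW`, stub `stub_boxGaussianDomination`: the OBJECTS of the one-scale expansion (assembly, step R4)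

The assembly of the one-scale expansion of the cold-wall `SU(2)` box (bricks R1–R7 of the lead's plan `PLAN-S3c-ii.md`, add. 3)
compares `boxState ρ β H` conditioned on the small-field event `coldGoodSet β ε H` with the product `boxDirichlet H ^{⊗3}` of three
colour copies of the temporal-gauge Dirichlet Gaussian D1'.  This file fixes the objects shared by the assembly files (definitions +
their elementary API; no analysis):

* `ColdFreeIdx H` — the index type of the free (non-forest) links of the cold box `Λ = boxEdges 4 (2H+1)` (so that
  `ColdFreeCfg H = ColdFreeIdx H → G`); `extZero w` — extension of free-link data by `0` to all edges of `ℤ⁴`;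
* `chartCfg w` — the `SU(2)` configuration whose every link is the gnomonic chart point `P(1, extZero w e)` (free links `P(1,w_e)`,
  forest links and the cold wall `P(1,0) = 1`); `coldExt_coldExt₁_gnomonicChart : coldExt (coldExt₁ (P(1,w_·))) = chartCfg w`;
* `TSpace H = Fin 3 → EuclideanSpace ℝ (DirFree H)` — three colour copies of the D1' variables; `unscaleT β H t` — the free-link chart
  data `w_e^i = t^i_e / √(2β)` read through `dirFreeEquiv`; **`extZero_unscaleT`**: its zero extension is `dirGlue H (t i) / √(2β)`, so
  chart circulations are Dirichlet circulations: `sCirc_extZero_unscaleT`;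
* `cfgT β H t = chartCfg (unscaleT β H t)`; `qObs H p t = ½ Σ_i (dirCirc H p (t i))²` (the quadratic/Gaussian surrogate of `β·cost_p`);
  `goodT β ε H` — the small-field event read in `t`; `tiltW β H t` — the tilt exponent
  `Σ_{p touching Λ} (qObs p − β·cost_p(cfgT t)) + Σ_e log((1+|w_e|²)⁻²)` (cubic Taylor remainder + gnomonic Jacobian);
* measurability of all of the above.
No sorry; standard axioms.  NOT a claim about the mass gap.
-/

set_option autoImplicit false

noncomputable section

open MeasureTheory Finset Quaternion
open Literature.Probability.LatticeModels (Site glueWith glueWith_apply_mem glueWith_apply_not_mem)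
open Literature.MathematicalPhysics.QuantumLattice
open Literature.MathematicalPhysics.QuantumFieldTheory
open Literature.MathematicalPhysics.QuantumFieldTheory.LatticeMaxwell
open Literature.MathematicalPhysics.QuantumFieldTheory.AxialGauge

namespace Summit.QuantumFields.YangMills.Theorems.WeakCouplingRates

/-- The index type of the FREE (non-forest) links of the cold box `Λ = boxEdges 4 (2H+1)`: `ColdFreeCfg H = ColdFreeIdx H → G`. -/
abbrev ColdFreeIdx (H : ℕ) : Type :=
  {e : ↥(boxEdges 4 (2 * H + 1)) // ¬ (e.1.2 = 0 ∧ ∀ k : Fin 4, 1 ≤ e.1.1 k ∧ e.1.1 k + 1 ≤ 2 * (H : ℤ))}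

variable {H : ℕ}

/-! ## Zero extension of free-link data -/

/-- Extension of free-link data by `0` to all edges of `ℤ⁴` (forest links and the cold wall carry `0`). -/
def extZero {V : Type*} [Zero V] (w : ColdFreeIdx H → V) : Literature.MathematicalPhysics.QuantumLattice.ZdEdge 4 → V := fun e =>
  if h : e ∈ boxEdges 4 (2 * H + 1) then
    (if hf : (e.2 = 0 ∧ ∀ k : Fin 4, 1 ≤ e.1 k ∧ e.1 k + 1 ≤ 2 * (H : ℤ)) then 0 else w ⟨⟨e, h⟩, hf⟩)
  else 0

/-- `extZero w` on a free link. -/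
@[simp] theorem extZero_apply_free {V : Type*} [Zero V] (w : ColdFreeIdx H → V) (e : ColdFreeIdx H) :
    extZero w e.1.1 = w e := by
  obtain ⟨⟨e, he⟩, hf⟩ := e
  unfold extZero
  rw [dif_pos he, dif_neg hf]

/-- `extZero w` off the cold box. -/
theorem extZero_of_not_mem {V : Type*} [Zero V] (w : ColdFreeIdx H → V) {e : Literature.MathematicalPhysics.QuantumLattice.ZdEdge 4}
    (he : e ∉ boxEdges 4 (2 * H + 1)) : extZero w e = 0 := by
  simp [extZero, he]

/-- `extZero w` on a forest link. -/
theorem extZero_of_forest {V : Type*} [Zero V] (w : ColdFreeIdx H → V) {e : Literature.MathematicalPhysics.QuantumLattice.ZdEdge 4}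
    (hf : e.2 = 0 ∧ ∀ k : Fin 4, 1 ≤ e.1 k ∧ e.1 k + 1 ≤ 2 * (H : ℤ)) : extZero w e = 0 := by
  by_cases he : e ∈ boxEdges 4 (2 * H + 1)
  · simp [extZero, he, hf]
  · exact extZero_of_not_mem w he

/-- Componentwise reading: `extZero w e i = extZero (fun f => w f i) e`. -/
theorem extZero_apply_pi {ι : Type*} {V : Type*} [Zero V] (w : ColdFreeIdx H → ι → V)
    (e : Literature.MathematicalPhysics.QuantumLattice.ZdEdge 4) (i : ι) :
    extZero w e i = extZero (fun f => w f i) e := by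
  unfold extZero
  split_ifs <;> rfl

/-- Scalars pull out: `extZero (fun f => w f / c) e = extZero w e / c`. -/
theorem extZero_div (w : ColdFreeIdx H → ℝ) (c : ℝ) (e : Literature.MathematicalPhysics.QuantumLattice.ZdEdge 4) :
    extZero (fun f => w f / c) e = extZero w e / c := by
  unfold extZero
  split_ifs <;> simp

/-- **Gluing free-link data through a map fixing the origin**: `coldExt (coldExt₁ (g ∘ w)) = g ∘ extZero w` whenever `g 0 = 1`. -/
theorem coldExt_coldExt₁_comp {G : Type*} [Group G] {V : Type*} [Zero V] (g : V → G) (hg : g 0 = 1) (w : ColdFreeIdx H → V) :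
    coldExt (coldExt₁ (fun e => g (w e))) = fun e => g (extZero w e) := by
  funext e
  by_cases he : e ∈ boxEdges 4 (2 * H + 1)
  · rw [coldExt_apply_mem _ ⟨e, he⟩, coldExt₁]
    by_cases hf : (e.2 = 0 ∧ ∀ k : Fin 4, 1 ≤ e.1 k ∧ e.1 k + 1 ≤ 2 * (H : ℤ))
    · rw [dif_pos hf, extZero_of_forest w hf, hg]
    · rw [dif_neg hf]
      unfold extZero
      rw [dif_pos he, dif_neg hf]
  · rw [coldExt_apply_not_mem _ he, extZero_of_not_mem w he, hg]

/-! ## The chart configuration -/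

/-- `gnomonicQuat 0 = 1`. -/
@[simp] theorem gnomonicQuat_zero : gnomonicQuat (0 : Fin 3 → ℝ) = 1 := by
  ext <;> simp [gnomonicQuat]

/-- The chart point of `0` is the identity: `P(1, 0) = 1`. -/
@[simp] theorem gnomonicChart_zero : gnomonicChart (0 : Fin 3 → ℝ) = 1 := by
  rw [gnomonicChart, gnomonicQuat_zero, quatToSU2_one]

/-- **The chart configuration** of free-link chart data `w`: every link of `ℤ⁴` is the gnomonic chart point `P(1, extZero w e)`
(free links `P(1, w_e)`, forest links and the cold wall `1`). -/
def chartCfg (w : ColdFreeIdx H → (Fin 3 → ℝ)) : LGConfig 4 (Matrix.specialUnitaryGroup (Fin 2) ℂ) :=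
  fun e => gnomonicChart (extZero w e)

/-- The gauge-fixed cold-wall configuration with chart links is the chart configuration. -/
theorem coldExt_coldExt₁_gnomonicChart (w : ColdFreeIdx H → (Fin 3 → ℝ)) :
    coldExt (coldExt₁ (fun e => gnomonicChart (w e))) = chartCfg w :=
  coldExt_coldExt₁_comp gnomonicChart gnomonicChart_zero w

/-- The chart configuration is `1` off the cold box. -/
theorem chartCfg_of_not_mem (w : ColdFreeIdx H → (Fin 3 → ℝ)) {e : Literature.MathematicalPhysics.QuantumLattice.ZdEdge 4}
    (he : e ∉ boxEdges 4 (2 * H + 1)) : chartCfg w e = 1 := by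
  rw [chartCfg, extZero_of_not_mem w he, gnomonicChart_zero]

/-- The chart configuration is `1` on the forest. -/
theorem chartCfg_of_forest (w : ColdFreeIdx H → (Fin 3 → ℝ)) {x : Site 4}
    (hx : ∀ k : Fin 4, 1 ≤ x k ∧ x k + 1 ≤ 2 * (H : ℤ)) : chartCfg w (x, 0) = 1 := by
  rw [chartCfg, extZero_of_forest w ⟨rfl, hx⟩, gnomonicChart_zero]

/-- The chart configuration is measurable in the chart data. -/
theorem measurable_chartCfg : Measurable (chartCfg (H := H)) := by
  refine measurable_pi_lambda _ fun e => measurable_gnomonicChart.comp ?_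
  change Measurable fun w : ColdFreeIdx H → (Fin 3 → ℝ) => extZero w e
  unfold extZero
  split_ifs
  · exact measurable_const
  · exact measurable_pi_apply _
  · exact measurable_const

/-! ## Three colour copies of the Dirichlet variables, and the unscaling `w = t/√(2β)` -/

variable (H) in
/-- Three colour copies of the free Dirichlet edge variables of D1' (`boxDirichlet H` lives on `EuclideanSpace ℝ (DirFree H)`). -/
abbrev TSpace : Type := Fin 3 → EuclideanSpace ℝ (DirFree H)

variable (H) in
/-- **Unscaling**: the free-link chart data `w_e^i = t^i_e / √(2β)` of the colour triple `t`, the free links of the forest gauge being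
identified with the free Dirichlet edges by `dirFreeEquiv`. -/
def unscaleT (β : ℝ) (t : TSpace H) : ColdFreeIdx H → (Fin 3 → ℝ) :=
  fun e i => t i ((dirFreeEquiv H).symm e) / Real.sqrt (2 * β)

/-- **The zero extension of the unscaled data is the glued Dirichlet field, unscaled**:
`extZero (unscaleT β H t) e i = dirGlue H (t i) e / √(2β)`. -/
theorem extZero_unscaleT (β : ℝ) (t : TSpace H) (e : Literature.MathematicalPhysics.QuantumLattice.ZdEdge 4) (i : Fin 3) :
    extZero (unscaleT H β t) e i = dirGlue H (WithLp.ofLp (t i)) e / Real.sqrt (2 * β) := by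
  rw [extZero_apply_pi]
  change extZero (fun f => t i ((dirFreeEquiv H).symm f) / Real.sqrt (2 * β)) e = _
  rw [extZero_div]
  congr 1
  by_cases he : e ∈ boxEdges 4 (2 * H + 1)
  · by_cases hf : (e.2 = 0 ∧ ∀ k : Fin 4, 1 ≤ e.1 k ∧ e.1 k + 1 ≤ 2 * (H : ℤ))
    · rw [extZero_of_forest _ hf]
      obtain ⟨x, j⟩ := e
      obtain ⟨hj, hx⟩ := hf
      simp only at hj hx
      subst hj
      exact (dirGlue_eq_zero_of_forest _ fun k => ⟨(hx k).1, by exact_mod_cast (hx k).2⟩).symm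
    · have hfree : e ∈ dirFreeEdges H := mem_dirFreeEdges.2 ⟨he, hf⟩
      have hbig : e ∈ boxEdgesAt dirCorner (2 * H + 3) := boxEdges_subset_boxEdgesAt_dirCorner H he
      have key : extZero (fun f => t i ((dirFreeEquiv H).symm f)) e = t i ((dirFreeEquiv H).symm ⟨⟨e, he⟩, hf⟩) := by
        unfold extZero
        rw [dif_pos he, dif_neg hf]
      rw [key, dirGlue]
      have hpin : ¬ (e ∉ dirFreeEdges H) := not_not.2 hfree
      rw [show glue (pin := fun e => e ∉ dirFreeEdges H) dirCorner (2 * H + 3) 0 (WithLp.ofLp (t i)) e =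
        WithLp.ofLp (t i) ⟨⟨e, hbig⟩, hpin⟩ from glue_apply_free 0 (WithLp.ofLp (t i)) ⟨⟨e, hbig⟩, hpin⟩]
      rfl
  · rw [extZero_of_not_mem _ he, dirGlue_eq_zero_of_not_mem _ he]

/-- **Chart circulations are Dirichlet circulations**: `sCirc (colour i of extZero (unscaleT β H t)) p = dirCirc H p (t i) / √(2β)`. -/
theorem sCirc_extZero_unscaleT (β : ℝ) (t : TSpace H) (p : Plaq 4) (i : Fin 3) :
    sCirc (fun e => extZero (unscaleT H β t) e i) p = dirCirc H p (t i) / Real.sqrt (2 * β) := by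
  simp only [extZero_unscaleT, sCirc, dirCirc_apply]
  ring

/-- `unscaleT` is measurable (indeed linear). -/
theorem measurable_unscaleT (β : ℝ) : Measurable (unscaleT H β) := by
  refine measurable_pi_lambda _ fun e => measurable_pi_lambda _ fun i => ?_
  change Measurable fun t : TSpace H => t i ((dirFreeEquiv H).symm e) / Real.sqrt (2 * β)
  refine Measurable.div_const ?_ _
  have h1 : Measurable fun t : TSpace H => t i := measurable_pi_apply i
  have h2 : Measurable fun s : EuclideanSpace ℝ (DirFree H) => s ((dirFreeEquiv H).symm e) :=
    (measurable_pi_apply ((dirFreeEquiv H).symm e)).comp (PiLp.continuous_ofLp 2 _).measurable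
  exact h2.comp h1

variable (H) in
/-- **Scaling**: the colour triple `t^i_e = √(2β) · w_e^i` of free-link chart data `w` (inverse to `unscaleT` for `β > 0`). -/
def scaleT (β : ℝ) (w : ColdFreeIdx H → (Fin 3 → ℝ)) : TSpace H :=
  fun i => WithLp.toLp 2 (fun e : DirFree H => Real.sqrt (2 * β) * w (dirFreeEquiv H e) i)

/-- `unscaleT ∘ scaleT = id` (`β > 0`). -/
theorem unscaleT_scaleT {β : ℝ} (hβ : 0 < β) (w : ColdFreeIdx H → (Fin 3 → ℝ)) : unscaleT H β (scaleT H β w) = w := by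
  have hc : Real.sqrt (2 * β) ≠ 0 := (Real.sqrt_pos.2 (by linarith)).ne'
  funext e i
  simp only [unscaleT, scaleT, Equiv.apply_symm_apply]
  exact mul_div_cancel_left₀ _ hc

/-- `scaleT ∘ unscaleT = id` (`β > 0`). -/
theorem scaleT_unscaleT {β : ℝ} (hβ : 0 < β) (t : TSpace H) : scaleT H β (unscaleT H β t) = t := by
  have hc : Real.sqrt (2 * β) ≠ 0 := (Real.sqrt_pos.2 (by linarith)).ne'
  funext i
  ext e
  simp only [unscaleT, scaleT, Equiv.symm_apply_apply]
  exact mul_div_cancel₀ _ hc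

variable (H) in
/-- **The scaling as a continuous linear equivalence** `(ColdFreeIdx H → ℝ³) ≃L[ℝ] TSpace H` (`β > 0`): the change of variables of the
one-scale expansion (its Jacobian is a constant, which cancels in normalised expectations). -/
def scaleEquiv {β : ℝ} (hβ : 0 < β) : (ColdFreeIdx H → (Fin 3 → ℝ)) ≃L[ℝ] TSpace H :=
  LinearEquiv.toContinuousLinearEquiv
    { toFun := scaleT H β
      invFun := unscaleT H β
      map_add' := fun w w' => by
        funext i; ext e; simp [scaleT, mul_add]
      map_smul' := fun c w => by
        funext i; ext e; simp [scaleT]; ring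
      left_inv := unscaleT_scaleT hβ
      right_inv := scaleT_unscaleT hβ }

/-- The scaling equivalence is `scaleT`. -/
@[simp] theorem scaleEquiv_apply {β : ℝ} (hβ : 0 < β) (w : ColdFreeIdx H → (Fin 3 → ℝ)) : scaleEquiv H hβ w = scaleT H β w := rfl

/-- Its inverse is `unscaleT`. -/
@[simp] theorem scaleEquiv_symm_apply {β : ℝ} (hβ : 0 < β) (t : TSpace H) : (scaleEquiv H hβ).symm t = unscaleT H β t := rfl

variable (H) in
/-- **The chart configuration of a colour triple** `t`: links `P(1, t_e/√(2β))` on the free links, `1` elsewhere. -/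
def cfgT (β : ℝ) (t : TSpace H) : LGConfig 4 (Matrix.specialUnitaryGroup (Fin 2) ℂ) := chartCfg (unscaleT H β t)

/-- `cfgT` is measurable. -/
theorem measurable_cfgT (β : ℝ) : Measurable (cfgT H β) := measurable_chartCfg.comp (measurable_unscaleT β)

variable (H) in
/-- **The quadratic (Gaussian) surrogate of `β·cost_p`**: `qObs H p t = ½ Σ_i (dirCirc H p (t i))²` (three colour components). -/
def qObs (p : Plaq 4) (t : TSpace H) : ℝ := 1 / 2 * ∑ i, dirCirc H p (t i) ^ 2

/-- `qObs` is nonnegative. -/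
theorem qObs_nonneg (p : Plaq 4) (t : TSpace H) : 0 ≤ qObs H p t := by
  unfold qObs; positivity

/-- `dirCirc H p` is measurable. -/
theorem measurable_dirCirc (p : Plaq 4) : Measurable (dirCirc H p) := by
  have h : ∀ e : Literature.MathematicalPhysics.QuantumLattice.ZdEdge 4,
      Measurable fun s : EuclideanSpace ℝ (DirFree H) => dirGlue H (WithLp.ofLp s) e := by
    intro e
    have hc : Measurable fun s : EuclideanSpace ℝ (DirFree H) => (WithLp.ofLp s : DirFree H → ℝ) :=
      (PiLp.continuous_ofLp 2 _).measurable
    unfold dirGlue glue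
    split_ifs
    · exact measurable_const
    · exact (measurable_pi_apply _).comp hc
    · exact measurable_const
  unfold dirCirc sCirc
  exact (((h _).add (h _)).sub (h _)).sub (h _)

/-- `qObs` is measurable. -/
theorem measurable_qObs (p : Plaq 4) : Measurable (qObs H p) := by
  unfold qObs
  exact measurable_const.mul (Finset.measurable_sum _ fun i _ => ((measurable_dirCirc p).comp (measurable_pi_apply i)).pow_const 2)

variable (H) in
/-- **The Gaussian reference of the one-scale expansion**: three independent colour copies of the Dirichlet Gaussian D1',
`boxDirichlet H ^{⊗3}` on `TSpace H`. -/
abbrev gauss3 : Measure (TSpace H) := Measure.pi fun _ : Fin 3 => boxDirichlet H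

variable (H) in
/-- **The small-field event read in the colour variables**: `cfgT β H t ∈ coldGoodSet β ε H` (every plaquette touching the cold box
has cost `< β^{2ε−1}` in the chart configuration). -/
def goodT (β ε : ℝ) : Set (TSpace H) := {t | cfgT H β t ∈ coldGoodSet β ε H}

/-- `goodT` is measurable. -/
theorem measurableSet_goodT (β ε : ℝ) : MeasurableSet (goodT H β ε) :=
  measurable_cfgT β (measurableSet_coldGoodSet β ε H)

variable (H) in
/-- **The tilt exponent** of the one-scale expansion: (quadratic surrogate minus `β`·cost, summed over the plaquettes touching the
cold box) plus the logarithm of the gnomonic Jacobian `Π_e (1+|w_e|²)⁻²`.  On `goodT` it is uniformly small (cubic Taylor remainder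
`362·β·η³` per plaquette, `2η²` per link). -/
def tiltW (β : ℝ) (t : TSpace H) : ℝ :=
  (∑ q ∈ plaquettesTouching (boxEdges 4 (2 * H + 1)),
      (qObs H (q.1, q.2.1.1, q.2.1.2) t - β * plaqCostAt (fundamentalRep (Fin 2)) q.1 q.2.1.1 q.2.1.2 (cfgT H β t))) +
    ∑ e : ColdFreeIdx H, Real.log (((1 + ∑ i, (unscaleT H β t e i) ^ 2)⁻¹) ^ 2)

/-- `tiltW` is measurable. -/
theorem measurable_tiltW (β : ℝ) : Measurable (tiltW H β) := by
  unfold tiltW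
  refine (Finset.measurable_sum _ fun q _ => (measurable_qObs _).sub
    (measurable_const.mul ((measurable_plaqCostAt _ _ _).comp (measurable_cfgT β)))).add
    (Finset.measurable_sum _ fun e _ => Real.measurable_log.comp ?_)
  refine ((measurable_const.add (Finset.measurable_sum _ fun i _ => ?_)).inv).pow_const 2
  exact ((measurable_pi_apply i).comp ((measurable_pi_apply e).comp (measurable_unscaleT β))).pow_const 2

end Summit.QuantumFields.YangMills.Theorems.WeakCouplingRates

end
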